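import Literature.AlgebraicGeometry.AbelianSchemes.SerreTensorComposition
import Literature.Algebra.Module.IdempotentMatrixFixedTensor
import HarnessLib

/-!
# The `𝒪`-module of points of Serre's tensor construction: `(A ⊗_𝒪 𝔞)(T) ≅ A(T) ⊗_𝒪 𝔞`, `𝒪`-linearly

Topic `AlgebraicGeometry/AbelianSchemes`, namespace `Literature.AlgebraicGeometry.AbelianSchemes.AbelianSchemeOver` (a carrier `RingAction.Pts`
with its `AddCommGroup`∕`Module 𝒪` structure — instances on THIS FILE'S OWN type synonym only — plus constructions with bodies and proved
theorems; no named fact, no `sorry`, no notation; any base `S`).  Cell `hodgecm-mathlib`, F0/P6 «MOD», P6a organ (g2) FILE 10 (FILE 2 ★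
`SerreTensorConstruction`, FILE 6b ★ `SerreTensorComposition`, (B) ★ `Algebra/Module/IdempotentMatrixFixedTensor`);
`--supports stmt-HodgeConjecture-24832`, count-neutral.  HC_CM is proved only modulo the 2 remaining named inputs (hLiu418, h413) until rung 0
closes; this file discharges none of them.

## Mathematics

For an abelian scheme `A/S` with commutative group law and a ring action `ι : 𝒪 → End_S(A)`, the `T`-valued points `A(T) = Hom_S(T, A)`
form an `𝒪`-module: addition is the group law, `a • x = ι(a) ∘ x`.  For `𝔞 = E·𝒪ⁿ` (`E² = E`) FILE 2 identified `(A ⊗_𝒪 𝔞)(T)` with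
`{x ∈ A(T)ⁿ : E·x = x}` as a set (and as a group); here this identification is promoted to an `𝒪`-LINEAR isomorphism onto the fixed
submodule of `E` on `A(T)ⁿ`, and composed with the algebraic identification `M ⊗_𝒪 E·𝒪ⁿ ≅ {v ∈ Mⁿ : E·v = v}` (★ (B)) to give
`(A ⊗_𝒪 𝔞)(T) ≅ A(T) ⊗_𝒪 𝔞` — the defining property of Serre's tensor construction on points (B. Conrad, *Gross–Zagier revisited* §7,
`(M ⊗_𝒪 A)(T) = M ⊗_𝒪 A(T)` for projective `M`).

## Contents

* §1 `RingAction.Pts act T` (= `Additive (T ⟶ A.X)`) with `AddCommGroup`, `Module O`; `Pts.mk`∕`Pts.hom` (`hom_add`, `hom_zero`, `hom_sum`,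
  `hom_smul : hom (a • x) = hom x ≫ ι a`, `hom_injective`), `Pts.comap` (naturality in `T`);
* §2 `hom_smulVecLin` (`E·v` on `A(T)ⁿ` is FILE 2's `matrixComp`), `mem_fixedSubmodule_pts_iff`;
* §3 (under the Prop instance `[IsCommMonObj (serreTensor act E hE).X]`, supplied by ★ `isCommMonObj_serreTensor`)
  **`serrePtsEquiv act E hE T : (serreAction act E hE).Pts T ≃ₗ[O] fixedSubmodule (act.Pts T) E`** (`hom_serrePtsEquiv_coe`, `hom_serrePtsEquiv_symm`);
* §4 **`serrePtsTensorEquiv act E hE T : (serreAction act E hE).Pts T ≃ₗ[O] act.Pts T ⊗[O] LinearMap.range (Matrix.toLin' E)`**,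
  `serrePtsTensorEquiv_symm_tmul_coe`.

## References
* [Conrad2004GrossZagier] B. Conrad, *Gross–Zagier revisited*, MSRI Publ. 49 (2004), §7 («The Serre tensor construction»).
* [Kottwitz1992] §5 (p. 390).
* Tree: ★ FILE 2, ★ FILE 6b (`matrixEnd_scalar_powProj`), ★ (B) `tensorRangeEquivFixed`.
-/

noncomputable section

universe u

open CategoryTheory CategoryTheory.Limits AlgebraicGeometry MonoidalCategory CartesianMonoidalCategory
open scoped MonObj

namespace Literature.AlgebraicGeometry.AbelianSchemes

namespace AbelianSchemeOver

variable {S : Scheme.{u}} {A : AbelianSchemeOver S} {O : Type*} [CommRing O] (act : A.RingAction O)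

/-! ## §1 The `𝒪`-module `A(T)` of `T`-valued points -/

/-- **The `𝒪`-module of `T`-valued points `A(T) = Hom_S(T, A)`** (written additively; the action is recorded in the type).
[cite: Conrad2004GrossZagier, §7] -/
def RingAction.Pts (_act : A.RingAction O) (T : Over S) : Type u := Additive (T ⟶ A.X)

namespace RingAction

variable (T : Over S)

/-- A point `f : T ⟶ A` as an element of the module `A(T)`. [cite: Conrad2004GrossZagier, §7] -/
def Pts.mk (f : T ⟶ A.X) : act.Pts T := Additive.ofMul f

/-- The morphism `T ⟶ A` underlying an element of `A(T)`. [cite: Conrad2004GrossZagier, §7] -/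
def Pts.hom (x : act.Pts T) : T ⟶ A.X := Additive.toMul x

/-- `hom (mk f) = f`. [cite: Conrad2004GrossZagier, §7] -/
@[simp] theorem Pts.hom_mk (f : T ⟶ A.X) : Pts.hom act T (Pts.mk act T f) = f := rfl

/-- `mk (hom x) = x`. [cite: Conrad2004GrossZagier, §7] -/
@[simp] theorem Pts.mk_hom (x : act.Pts T) : Pts.mk act T (Pts.hom act T x) = x := rfl

/-- `hom` is injective. [cite: Conrad2004GrossZagier, §7] -/
theorem Pts.hom_injective : Function.Injective (Pts.hom act T) := Additive.toMul.injective

variable [IsCommMonObj A.X]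

/-- `A(T)` is an abelian group under the (commutative) group law of `A`. [cite: Conrad2004GrossZagier, §7] -/
instance Pts.instAddCommGroup : AddCommGroup (act.Pts T) := inferInstanceAs (AddCommGroup (Additive (T ⟶ A.X)))

/-- Addition in `A(T)` is the group law: `hom (x + y) = hom x * hom y`. [cite: Conrad2004GrossZagier, §7] -/
theorem Pts.hom_add (x y : act.Pts T) : Pts.hom act T (x + y) = Pts.hom act T x * Pts.hom act T y := rfl

/-- `hom 0 = 1` (the unit section). [cite: Conrad2004GrossZagier, §7] -/
theorem Pts.hom_zero : Pts.hom act T 0 = 1 := rfl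

/-- `hom (∑ f) = ∏ hom ∘ f`. [cite: Conrad2004GrossZagier, §7] -/
theorem Pts.hom_sum {κ : Type*} (s : Finset κ) (f : κ → act.Pts T) : Pts.hom act T (∑ i ∈ s, f i) = ∏ i ∈ s, Pts.hom act T (f i) := by
  classical
  induction s using Finset.induction_on with
  | empty => rw [Finset.sum_empty, Finset.prod_empty]; rfl
  | insert i s hi ih => rw [Finset.sum_insert hi, Finset.prod_insert hi, Pts.hom_add, ih]

/-- The `𝒪`-module structure on `A(T)`: `a • x = x ≫ ι(a)`. [cite: Conrad2004GrossZagier, §7] -/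
instance Pts.instModule : Module O (act.Pts T) where
  smul a x := Pts.mk act T (Pts.hom act T x ≫ act.i a)
  one_smul x := by
    change Pts.mk act T (Pts.hom act T x ≫ act.i 1) = x
    rw [act.i_one, Category.comp_id, Pts.mk_hom]
  mul_smul a b x := by
    change Pts.mk act T (Pts.hom act T x ≫ act.i (a * b)) = Pts.mk act T (Pts.hom act T (Pts.mk act T (Pts.hom act T x ≫ act.i b)) ≫ act.i a)
    rw [act.comp_i_mul, Pts.hom_mk]
  smul_zero a := by
    haveI := act.isMonHom a
    change Pts.mk act T (Pts.hom act T 0 ≫ act.i a) = 0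
    rw [Pts.hom_zero, MonObj.one_comp]; rfl
  smul_add a x y := by
    haveI := act.isMonHom a
    apply Pts.hom_injective act T
    change (Pts.hom act T x * Pts.hom act T y) ≫ act.i a = (Pts.hom act T x ≫ act.i a) * (Pts.hom act T y ≫ act.i a)
    rw [MonObj.mul_comp]
  add_smul a b x := by
    apply Pts.hom_injective act T
    change Pts.hom act T x ≫ act.i (a + b) = (Pts.hom act T x ≫ act.i a) * (Pts.hom act T x ≫ act.i b)
    rw [act.comp_i_add]
  zero_smul x := by
    change Pts.mk act T (Pts.hom act T x ≫ act.i 0) = 0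
    rw [(act.comp_i_zero_one (Pts.hom act T x)).1]; rfl

/-- `hom (a • x) = hom x ≫ ι(a)`. [cite: Conrad2004GrossZagier, §7] -/
theorem Pts.hom_smul (a : O) (x : act.Pts T) : Pts.hom act T (a • x) = Pts.hom act T x ≫ act.i a := rfl

/-- `a • mk f = mk (f ≫ ι(a))`. [cite: Conrad2004GrossZagier, §7] -/
theorem Pts.smul_mk (a : O) (f : T ⟶ A.X) : a • Pts.mk act T f = Pts.mk act T (f ≫ act.i a) := rfl

variable {T} in
/-- Naturality in `T`: `t : T′ ⟶ T` induces the `𝒪`-linear map `A(T) → A(T′)`, `x ↦ t ≫ x`. [cite: Conrad2004GrossZagier, §7] -/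
def Pts.comap {T' : Over S} (t : T' ⟶ T) : act.Pts T →ₗ[O] act.Pts T' where
  toFun x := Pts.mk act T' (t ≫ Pts.hom act T x)
  map_add' x y := by
    apply Pts.hom_injective act T'
    change t ≫ (Pts.hom act T x * Pts.hom act T y) = (t ≫ Pts.hom act T x) * (t ≫ Pts.hom act T y)
    rw [MonObj.comp_mul]
  map_smul' a x := by
    apply Pts.hom_injective act T'
    change t ≫ (Pts.hom act T x ≫ act.i a) = (t ≫ Pts.hom act T x) ≫ act.i a
    rw [Category.assoc]

/-- `hom (comap t x) = t ≫ hom x`. [cite: Conrad2004GrossZagier, §7] -/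
theorem Pts.hom_comap {T' : Over S} (t : T' ⟶ T) (x : act.Pts T) : Pts.hom act T' (Pts.comap act t x) = t ≫ Pts.hom act T x := rfl

end RingAction

open RingAction

/-! ## §2 `E·v` on `A(T)ⁿ` is FILE 2's `matrixComp` -/

section MatrixComp

variable [IsCommMonObj A.X] {n : ℕ} (E : Matrix (Fin n) (Fin n) O) (T : Over S)

/-- `hom ((E·v)_j) = ∏_k hom(v_k) ≫ ι(E_{jk}) = matrixComp act E (hom ∘ v) j`. [cite: Kottwitz1992, §5 (p. 390)] -/
theorem hom_smulVecLin (v : Fin n → act.Pts T) (j : Fin n) :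
    Pts.hom act T (Literature.Algebra.Module.IdempotentMatrix.smulVecLin (act.Pts T) E v j) =
      matrixComp act E (fun k => Pts.hom act T (v k)) j := by
  rw [Literature.Algebra.Module.IdempotentMatrix.smulVecLin_apply, Pts.hom_sum]
  rfl

/-- `v ∈ Fix_E(A(T)ⁿ) ↔ E · (hom ∘ v) = hom ∘ v`. [cite: Kottwitz1992, §5 (p. 390)] -/
theorem mem_fixedSubmodule_pts_iff (v : Fin n → act.Pts T) :
    v ∈ Literature.Algebra.Module.IdempotentMatrix.fixedSubmodule (act.Pts T) E ↔
      matrixComp act E (fun k => Pts.hom act T (v k)) = fun k => Pts.hom act T (v k) := by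
  rw [Literature.Algebra.Module.IdempotentMatrix.mem_fixedSubmodule_iff]
  constructor
  · intro h
    funext j
    rw [← hom_smulVecLin, h]
  · intro h
    funext j
    apply Pts.hom_injective act T
    rw [hom_smulVecLin, h]

end MatrixComp

/-! ## §3 `(A ⊗_𝒪 𝔞)(T) ≅ Fix_E(A(T)ⁿ)`, `𝒪`-linearly -/

section Pts

variable [IsCommMonObj A.X] {n : ℕ} (E : Matrix (Fin n) (Fin n) O) (hE : E * E = E) (T : Over S)

/-- The coordinates `(x ≫ ι ≫ pr_k)_k` of a point of `A ⊗_𝒪 𝔞`, as a fixed vector of `E` on `A(T)ⁿ`. [cite: Conrad2004GrossZagier, §7] -/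
def serrePtsFun (x : (serreAction act E hE).Pts T) : Literature.Algebra.Module.IdempotentMatrix.fixedSubmodule (act.Pts T) E :=
  ⟨fun k => Pts.mk act T ((serreHomEquiv act E hE T (Pts.hom _ T x) : Fin n → (T ⟶ A.X)) k),
    (mem_fixedSubmodule_pts_iff act E T _).2 (serreHomEquiv act E hE T (Pts.hom _ T x)).2⟩

/-- The inverse: a fixed vector `v` goes to `(hom ∘ v) ≫ π`. [cite: Conrad2004GrossZagier, §7] -/
def serrePtsInv (v : Literature.Algebra.Module.IdempotentMatrix.fixedSubmodule (act.Pts T) E) : (serreAction act E hE).Pts T :=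
  Pts.mk _ T ((serreHomEquiv act E hE T).symm ⟨fun k => Pts.hom act T (v.1 k), (mem_fixedSubmodule_pts_iff act E T v.1).1 v.2⟩)

/-- `hom ((serrePtsFun x)_k) = (hom x ≫ ι) ≫ pr_k`. [cite: Conrad2004GrossZagier, §7] -/
theorem hom_serrePtsFun_coe (x : (serreAction act E hE).Pts T) (k : Fin n) :
    Pts.hom act T ((serrePtsFun act E hE T x : Fin n → act.Pts T) k) = (Pts.hom _ T x ≫ serreι act E hE) ≫ A.powProj n k := rfl

variable [IsCommMonObj (serreTensor act E hE).X]

/-- **`(A ⊗_𝒪 𝔞)(T) ≃ₗ[𝒪] {v ∈ A(T)ⁿ : E·v = v}`**: FILE 2's `serreHomEquiv`, promoted to an `𝒪`-linear isomorphism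
(the Prop instance `[IsCommMonObj (A ⊗_𝒪 𝔞).X]` is ★ `isCommMonObj_serreTensor`).
[cite: Conrad2004GrossZagier, §7] -/
def serrePtsEquiv : (serreAction act E hE).Pts T ≃ₗ[O] Literature.Algebra.Module.IdempotentMatrix.fixedSubmodule (act.Pts T) E where
  toFun := serrePtsFun act E hE T
  invFun := serrePtsInv act E hE T
  map_add' x y := by
    apply Subtype.ext
    funext k
    apply Pts.hom_injective act T
    change (serreHomEquiv act E hE T (Pts.hom _ T x * Pts.hom _ T y) : Fin n → (T ⟶ A.X)) k =
      (serreHomEquiv act E hE T (Pts.hom _ T x) : Fin n → (T ⟶ A.X)) k * (serreHomEquiv act E hE T (Pts.hom _ T y) : Fin n → (T ⟶ A.X)) k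
    rw [serreHomEquiv_mul, Pi.mul_apply]
  map_smul' a x := by
    apply Subtype.ext
    funext k
    apply Pts.hom_injective act T
    change ((Pts.hom _ T x ≫ (serreAction act E hE).i a) ≫ serreι act E hE) ≫ A.powProj n k =
      ((Pts.hom _ T x ≫ serreι act E hE) ≫ A.powProj n k) ≫ act.i a
    simp only [Category.assoc, serreAction_i_comp_ι_assoc, matrixEnd_scalar_powProj]
  left_inv x := by
    apply Pts.hom_injective _ T
    change (serreHomEquiv act E hE T).symm _ = Pts.hom _ T x
    rw [Equiv.symm_apply_eq]
    exact Subtype.ext rfl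
  right_inv v := by
    apply Subtype.ext
    funext k
    apply Pts.hom_injective act T
    change (serreHomEquiv act E hE T (Pts.hom _ T (Pts.mk _ T ((serreHomEquiv act E hE T).symm _))) : Fin n → (T ⟶ A.X)) k = _
    rw [Pts.hom_mk, Equiv.apply_symm_apply]

/-- Coordinates of `serrePtsEquiv x`: `hom ((serrePtsEquiv x)_k) = hom x ≫ ι ≫ pr_k`. [cite: Conrad2004GrossZagier, §7] -/
theorem hom_serrePtsEquiv_coe (x : (serreAction act E hE).Pts T) (k : Fin n) :
    Pts.hom act T ((serrePtsEquiv act E hE T x : Fin n → act.Pts T) k) = Pts.hom _ T x ≫ serreι act E hE ≫ A.powProj n k := by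
  rw [← Category.assoc]; rfl

/-- `hom (serrePtsEquiv⁻¹ v) = (hom ∘ v) ≫ π`. [cite: Conrad2004GrossZagier, §7] -/
theorem hom_serrePtsEquiv_symm (v : Literature.Algebra.Module.IdempotentMatrix.fixedSubmodule (act.Pts T) E) :
    Pts.hom _ T ((serrePtsEquiv act E hE T).symm v) = (powLift fun k => Pts.hom act T (v.1 k)) ≫ serreπ act E hE := rfl

/-! ## §4 `(A ⊗_𝒪 𝔞)(T) ≅ A(T) ⊗_𝒪 𝔞` -/

open scoped TensorProduct in
/-- **`(A ⊗_𝒪 𝔞)(T) ≃ₗ[𝒪] A(T) ⊗_𝒪 𝔞`** for `𝔞 = E·𝒪ⁿ = range E` — the defining property of Serre's tensor construction on `T`-points.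
[cite: Conrad2004GrossZagier, §7] -/
def serrePtsTensorEquiv :
    (serreAction act E hE).Pts T ≃ₗ[O] act.Pts T ⊗[O] LinearMap.range (Matrix.toLin' E) :=
  (serrePtsEquiv act E hE T).trans (Literature.Algebra.Module.IdempotentMatrix.tensorRangeEquivFixed (act.Pts T) E hE).symm

open scoped TensorProduct in
/-- The inverse on pure tensors: `serrePtsTensorEquiv⁻¹ (x ⊗ v)` is the point of `A ⊗_𝒪 𝔞` with coordinates `(v_k • x)_k`
(`v ∈ E·𝒪ⁿ ⊆ 𝒪ⁿ`). [cite: Conrad2004GrossZagier, §7] -/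
theorem serrePtsTensorEquiv_symm_tmul_coe (x : act.Pts T) (v : LinearMap.range (Matrix.toLin' E)) (k : Fin n) :
    (serrePtsEquiv act E hE T ((serrePtsTensorEquiv act E hE T).symm (x ⊗ₜ v)) : Fin n → act.Pts T) k = (v : Fin n → O) k • x := by
  change (serrePtsEquiv act E hE T ((serrePtsEquiv act E hE T).symm
    (Literature.Algebra.Module.IdempotentMatrix.tensorRangeEquivFixed (act.Pts T) E hE (x ⊗ₜ v))) : Fin n → act.Pts T) k = _
  rw [LinearEquiv.apply_symm_apply, Literature.Algebra.Module.IdempotentMatrix.tensorRangeEquivFixed_tmul_coe]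

end Pts

end AbelianSchemeOver

end Literature.AlgebraicGeometry.AbelianSchemes

end
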